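import Summits.HodgeConjecture.HodgeCM.PerL34.LocalFactors.DilationModel_1

/-! PORT of `HodgeCM/PerL34/LocalFactors/DilationModel.lean` (HodgeCMPerL run 82) — part 2: continuation of `Summits.HodgeConjecture.HodgeCM.PerL34.LocalFactors.DilationModel_1` (split at a top-level declaration boundary by port_pkg.py; scope re-opened below; declarations unchanged). -/

-- port_pkg: scope re-opened for this part (file-level context, then the namespace/section stack open at the cut)
set_option autoImplicit false
noncomputable section
open MeasureTheory MeasureTheory.Measure Set Metric Complex ComplexConjugate
open scoped ENNReal NNReal Pointwise InnerProductSpace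
namespace HodgeCM
namespace PerL34
namespace LocalFactors
namespace DilationModel
section SplitPlace
variable {F : Type} [NormedField F] [IsUltrametricDist F] [ProperSpace F] {n : ℕ}
attribute [local instance] unitsBorel
attribute [local instance] borelSpace_units
variable [MeasurableSpace (Fin n → F)] [BorelSpace (Fin n → F)] (μV : Measure (Fin n → F)) [μV.IsAddHaarMeasure]
variable (x₀ : Fin n → F) (r : ℝ)
variable (μG : Measure Fˣ) [μG.IsHaarMeasure] [μG.Regular] (ν χ' : Fˣ →* Circle)
/-- **The split-place local-factor datum, CONSTRUCTED** (tex ll. 608–611, 617–618): `G = Fˣ` with a Haar measure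
`μG = d^×y` (any normalisation; `Measure.haar`, or `haarMeasure K₀` with `K₀ = 𝒪^×` for `vol(𝒪^×) = 1`),
`Sp = L²(Fⁿ, μV)`, `ω = dilationRep μV ν` (`(ω(y)f)(x) = ν(y)|y|^{n/2} f(yx)`), `φ = 1_D` (`D = closedBall x₀ r`),
`χ = χ'`. -/
def splitIntegrand : EulerFactorisation.LocalIntegrand where
  G := Fˣ
  μ := μG
  Sp := Lp ℂ 2 μV
  ω := dilationRep μV ν
  φ := ballIndicator μV x₀ r
  χ := fun y => (χ' y : ℂ)
  chi_inv := fun y => by rw [map_inv, Circle.coe_inv_eq_conj]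

/-- the model equation D4 for `φ_v = 1_D`, now a THEOREM: `⟪1_D, ω(y) 1_D⟫ = ν(y)|y|^{n/2} · vol(D ∩ y⁻¹D)`. -/
theorem splitIntegrand_coeff_eq (y : Fˣ) :
    ⟪(splitIntegrand μV x₀ r μG ν χ').φ,
      (splitIntegrand μV x₀ r μG ν χ').ω y (splitIntegrand μV x₀ r μG ν χ').φ⟫_ℂ
      = ballCoeff (extendUnits (weight (Fin n → F) ν)) μV x₀ r (y : F) := by
  change ⟪ballIndicator μV x₀ r, dilationRep μV ν y (ballIndicator μV x₀ r)⟫_ℂ = _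
  rw [ballIndicator, inner_indicator_dilationRep, ballCoeff, extendUnits_val]
  rfl

/-- its integrand is `f(y) = ν(y)|y|^{n/2} vol(D ∩ y⁻¹D) · χ'(y)` -/
theorem splitIntegrand_f (y : Fˣ) :
    (splitIntegrand μV x₀ r μG ν χ').f y
      = ballCoeff (extendUnits (weight (Fin n → F) ν)) μV x₀ r (y : F) * (χ' y : ℂ) := by
  rw [EulerFactorisation.LocalIntegrand.f, splitIntegrand_coeff_eq]
  rfl

/-- **`HasSplitModel` DISCHARGED BY CONSTRUCTION.**  Hypotheses: `0 < r < ‖x₀‖` (i.e. `x₀ ≠ 0`, `N > ord x₀`) and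
the two unitary characters `ν` ("up to a unitary character") and `χ'_v` trivial on `U₁` ("N so large that
`U₁ ⊂ ker χ'`" — supplied by `KernelRadius.exists_radius_forall_U1_eq_one`). -/
theorem hasSplitModel_splitIntegrand (hr : r < ‖x₀‖) (hr0 : 0 < r)
    (hν : ∀ y : Fˣ, (y : F) ∈ U1 x₀ r → ν y = 1) (hχ : ∀ y : Fˣ, (y : F) ∈ U1 x₀ r → χ' y = 1) :
    HasSplitModel (splitIntegrand μV x₀ r μG ν χ') := by
  refine ⟨F, inferInstance, inferInstance, inferInstance, n, inferInstance, μV, inferInstance, inferInstance,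
    extendUnits (weight (Fin n → F) ν), extendUnits (fun y => (χ' y : ℂ)), x₀, r, (Units.val : Fˣ → F),
    hr, hr0, extendUnits_weight_eq_one ν hr hν, extendUnits_char_eq_one χ' hr hχ,
    measurableSet_val_preimage_U1 x₀ hr0, splitIntegrand_coeff_eq μV x₀ r μG ν χ',
    fun y => (extendUnits_val _ y).symm, ?_, ?_⟩
  · change μG ((Units.val : Fˣ → F) ⁻¹' U1 x₀ r) ≠ 0
    exact ((isOpen_U1 hr0).preimage Units.continuous_val).measure_ne_zero _
      ⟨1, show ((1 : Fˣ) : F) ∈ U1 x₀ r by rw [Units.val_one]; exact one_mem_U1 hr0.le⟩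
  · change μG ((Units.val : Fˣ → F) ⁻¹' U1 x₀ r) ≠ ⊤
    exact (isCompact_val_preimage_U1 hr hr0).measure_lt_top.ne

/-- Hence (landed `loc_I_pos_of_hasSplitModel`, tex l. 622–623): **`0 < I_v(φ_v)` at a split place, for the
constructed datum** — no model hypothesis left. -/
theorem splitIntegrand_I_pos (hr : r < ‖x₀‖) (hr0 : 0 < r)
    (hν : ∀ y : Fˣ, (y : F) ∈ U1 x₀ r → ν y = 1) (hχ : ∀ y : Fˣ, (y : F) ∈ U1 x₀ r → χ' y = 1) :
    0 < (splitIntegrand μV x₀ r μG ν χ').I :=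
  loc_I_pos_of_hasSplitModel _ (hasSplitModel_splitIntegrand μV x₀ r μG ν χ' hr hr0 hν hχ)

/-- **TRANSFER to any local-factor datum whose matrix coefficient at `φ_v` is (a positive multiple of) the
dilation model's at `1_D`** — the form in which N31h's canonical pieces (`PureTensor.localIntegrand`, global
space, `ω ∘ ι_v`, pure tensor `φ`) consume D4: the single hypothesis `hcoeff` is PerL's sentence "it is
`L_{0,v}^×` acting … by `(ω(y)φ)(x) = |y|^{3/2}φ(yx)` up to a unitary character" read on the chosen vector
(`c = ∏_{w ≠ v} ‖φ_w‖²` for a pure tensor), `t : U(W_i)(L_{0,v}) → L_{0,v}^×` the identification. -/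
theorem hasSplitModel_of_coeff (L : EulerFactorisation.LocalIntegrand) (t : L.G → Fˣ) (c : ℝ) (hc : 0 < c)
    (hr : r < ‖x₀‖) (hr0 : 0 < r)
    (hν : ∀ y : Fˣ, (y : F) ∈ U1 x₀ r → ν y = 1) (hχ : ∀ y : Fˣ, (y : F) ∈ U1 x₀ r → χ' y = 1)
    (hcoeff : ∀ y, ⟪L.φ, L.ω y L.φ⟫_ℂ
      = (c : ℂ) * ⟪ballIndicator μV x₀ r, dilationRep μV ν (t y) (ballIndicator μV x₀ r)⟫_ℂ)
    (hchar : ∀ y, L.χ y = (χ' (t y) : ℂ))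
    (hmeas : MeasurableSet (t ⁻¹' ((Units.val : Fˣ → F) ⁻¹' U1 x₀ r)))
    (hpos : L.μ (t ⁻¹' ((Units.val : Fˣ → F) ⁻¹' U1 x₀ r)) ≠ 0)
    (hfin : L.μ (t ⁻¹' ((Units.val : Fˣ → F) ⁻¹' U1 x₀ r)) ≠ ⊤) :
    HasSplitModel L := by
  haveI : (ENNReal.ofReal c • μV).IsOpenPosMeasure :=
    isOpenPosMeasure_smul μV (ENNReal.ofReal_pos.mpr hc).ne'
  haveI : IsFiniteMeasureOnCompacts (ENNReal.ofReal c • μV) :=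
    IsFiniteMeasureOnCompacts.smul μV ENNReal.ofReal_ne_top
  refine ⟨F, inferInstance, inferInstance, inferInstance, n, inferInstance, ENNReal.ofReal c • μV,
    inferInstance, inferInstance, extendUnits (weight (Fin n → F) ν), extendUnits (fun y => (χ' y : ℂ)),
    x₀, r, fun y => (t y : F), hr, hr0, extendUnits_weight_eq_one ν hr hν, extendUnits_char_eq_one χ' hr hχ,
    hmeas, fun y => ?_, fun y => by rw [hchar, extendUnits_val], hpos, hfin⟩
  rw [hcoeff y, ballIndicator, inner_indicator_dilationRep, ballCoeff, extendUnits_val,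
    measureReal_ennreal_smul_apply, ENNReal.toReal_ofReal hc.le, Complex.ofReal_mul, ← mul_assoc, ← mul_assoc,
    mul_comm (c : ℂ)]
  rfl

end SplitPlace

end DilationModel
end LocalFactors
end PerL34
end HodgeCM

end
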